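import Summits.Ventures.Crystal3D.Theorems.StickyWulffConstantStackingLiminfLayerChainV4Defs
import HarnessLib

/-!
# Level-set bounds for the plateau functional (line `LayerChain` v4, crux `StackingLiminf`,
# stmt-Ventures-19145): `a · |{a < w}|^{2/3} ≤ plateau w` and the mass above a level

Route `StickyWulffConstant` of the venture `Summits/Ventures/Crystal3D` (cell `crystal3d-full`).
For a compactly supported `w` bounded by `Wmax` (continuous for the mass lemmas):
* `level_mul_rpow_le_plateau` — for `0 < a`: `a · (|{y | a < w y}|)^{2/3} ≤ plateau w`
  (the integrand `t ↦ |{t < w}|^{2/3}` of `plateau` is antitone, integrable on `(0, ∞)` — bounded by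
  `|supp w|^{2/3}` and zero beyond `Wmax` — and `≥ |{a < w}|^{2/3}` on `(0, a]`);
* `integral_eq_below_add_above` / `setIntegral_above_le` — `∫ w = ∫_{w ≤ a} w + ∫_{a < w} w` and
  `∫_{a < w} w ≤ Wmax · |{a < w}|`.
These are the layer-cake half of the assembly of stub (C) `stub_plateauBound`.
WHAT THIS IS NOT: not stub (C); rung F-C1 not moved.
-/

noncomputable section

namespace Summit.Ventures.Crystal3D.Theorems.PlateauHeight

open MeasureTheory Set Metric
open Summit.Ventures.Crystal3D.Cruxes.StackingLiminf.LayerChainV4 (plateau)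

/-- The superlevel sets of a positive level lie in the support. -/
theorem superlevel_subset_tsupport {w : (Fin 3 → ℝ) → ℝ} {t : ℝ} (ht : 0 < t) :
    {y | t < w y} ⊆ tsupport w := fun _ hy =>
  subset_tsupport _ (Function.mem_support.2 (ht.trans hy).ne')

/-- **Level bound for the plateau functional.**  For continuous compactly supported `w` with
`w ≤ Wmax` and a level `0 < a`: `a · |{a < w}|^{2/3} ≤ plateau w`. -/
theorem level_mul_rpow_le_plateau {w : (Fin 3 → ℝ) → ℝ}
    (hws : HasCompactSupport w) {Wmax : ℝ} (hwle : ∀ y, w y ≤ Wmax) {a : ℝ} (ha : 0 < a) :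
    a * ((volume {y | a < w y}).toReal) ^ ((2 : ℝ) / 3) ≤ plateau w := by
  have hKc : IsCompact (tsupport w) := hws.isCompact
  have hKfin : volume (tsupport w) < ⊤ := hKc.measure_lt_top
  -- the integrand and its properties
  set f : ℝ → ℝ := fun t => ((volume {y : Fin 3 → ℝ | t < w y}).toReal) ^ ((2 : ℝ) / 3) with hf
  have hmeas1 : Measurable fun t : ℝ => volume {y : Fin 3 → ℝ | t < w y} :=
    Antitone.measurable fun s t hst => measure_mono fun y (hy : t < w y) => lt_of_le_of_lt hst hy
  have hfm : Measurable f := (hmeas1.ennreal_toReal).pow_const _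
  have hf0 : ∀ t, 0 ≤ f t := fun t => by positivity
  have hfin : ∀ t, 0 < t → volume {y : Fin 3 → ℝ | t < w y} < ⊤ := fun t ht =>
    lt_of_le_of_lt (measure_mono (superlevel_subset_tsupport ht)) hKfin
  -- bound and vanishing
  set C : ℝ := ((volume (tsupport w)).toReal) ^ ((2 : ℝ) / 3) with hC
  have hfle : ∀ t, 0 < t → f t ≤ C := by
    intro t ht
    exact Real.rpow_le_rpow ENNReal.toReal_nonneg
      (ENNReal.toReal_mono hKfin.ne (measure_mono (superlevel_subset_tsupport ht))) (by norm_num)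
  have hfzero : ∀ t, Wmax ≤ t → f t = 0 := by
    intro t ht
    have : {y : Fin 3 → ℝ | t < w y} = ∅ := by
      ext y
      simp only [mem_setOf_eq, mem_empty_iff_false, iff_false, not_lt]
      exact (hwle y).trans ht
    rw [hf]
    simp only [this, measure_empty, ENNReal.toReal_zero]
    exact Real.zero_rpow (by norm_num)
  -- integrability on `(0, ∞)`
  have hint : IntegrableOn f (Ioi 0) := by
    have hmax : 0 < max Wmax 1 := lt_max_of_lt_right one_pos
    have e : Ioi (0 : ℝ) = Ioc 0 (max Wmax 1) ∪ Ioi (max Wmax 1) := by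
      rw [Ioc_union_Ioi_eq_Ioi (le_max_of_le_right zero_le_one)]
    rw [e]
    refine IntegrableOn.union ?_ ?_
    · refine Integrable.mono' (g := fun _ => C) ?_ hfm.aestronglyMeasurable ?_
      · exact (integrableOn_const_iff).2 (Or.inr measure_Ioc_lt_top)
      · refine (ae_restrict_iff' measurableSet_Ioc).2 (ae_of_all _ fun t ht => ?_)
        rw [Real.norm_eq_abs, abs_of_nonneg (hf0 t)]
        exact hfle t ht.1
    · refine IntegrableOn.congr_fun integrableOn_zero (fun t ht => ?_) measurableSet_Ioi
      exact (hfzero t ((le_max_left _ _).trans (le_of_lt ht))).symm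
  -- compare with the constant `|{a < w}|^{2/3}` on `(0, a]`
  have hsub : Ioc 0 a ⊆ Ioi (0 : ℝ) := fun t ht => ht.1
  calc a * ((volume {y | a < w y}).toReal) ^ ((2 : ℝ) / 3)
      = ∫ _ in Ioc 0 a, ((volume {y | a < w y}).toReal) ^ ((2 : ℝ) / 3) := by
        rw [setIntegral_const, smul_eq_mul, measureReal_def, Real.volume_Ioc, sub_zero,
          ENNReal.toReal_ofReal ha.le]
    _ ≤ ∫ t in Ioc 0 a, f t := by
        refine setIntegral_mono_on ((integrableOn_const_iff).2 (Or.inr measure_Ioc_lt_top))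
          (hint.mono_set hsub) measurableSet_Ioc fun t ht => ?_
        exact Real.rpow_le_rpow ENNReal.toReal_nonneg
          (ENNReal.toReal_mono (hfin t ht.1).ne (measure_mono fun y (hy : a < w y) =>
            lt_of_le_of_lt ht.2 hy)) (by norm_num)
    _ ≤ ∫ t in Ioi 0, f t := setIntegral_mono_set hint (ae_of_all _ hf0) (ae_of_all _ hsub)
    _ = plateau w := rfl

/-- **Mass above a level.**  `∫_{a < w} w ≤ Wmax · |{a < w}|` for continuous `w ≤ Wmax` with compact
support and `0 < a`. -/
theorem setIntegral_above_le {w : (Fin 3 → ℝ) → ℝ} (hwc : Continuous w) (hws : HasCompactSupport w)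
    {Wmax : ℝ} (hwle : ∀ y, w y ≤ Wmax) {a : ℝ} (ha : 0 < a) :
    ∫ y in {y | a < w y}, w y ≤ Wmax * (volume {y | a < w y}).toReal := by
  have hfin : volume {y : Fin 3 → ℝ | a < w y} < ⊤ :=
    lt_of_le_of_lt (measure_mono (superlevel_subset_tsupport ha)) hws.isCompact.measure_lt_top
  have hm : MeasurableSet {y : Fin 3 → ℝ | a < w y} := measurableSet_lt measurable_const hwc.measurable
  calc ∫ y in {y | a < w y}, w y ≤ ∫ _ in {y | a < w y}, Wmax :=
        setIntegral_mono_on (hwc.integrable_of_hasCompactSupport hws).integrableOn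
          ((integrableOn_const_iff).2 (Or.inr hfin)) hm fun y _ => hwle y
    _ = Wmax * (volume {y | a < w y}).toReal := by
        rw [setIntegral_const, smul_eq_mul, measureReal_def, mul_comm]

/-- **Mass split at a level.**  `∫ w = ∫_{w ≤ a} w + ∫_{a < w} w`. -/
theorem integral_eq_below_add_above {w : (Fin 3 → ℝ) → ℝ} (hwc : Continuous w)
    (hws : HasCompactSupport w) (a : ℝ) :
    ∫ y, w y = (∫ y in {y | w y ≤ a}, w y) + ∫ y in {y | a < w y}, w y := by
  have hm : MeasurableSet {y : Fin 3 → ℝ | w y ≤ a} := measurableSet_le hwc.measurable measurable_const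
  have e : {y : Fin 3 → ℝ | a < w y} = {y : Fin 3 → ℝ | w y ≤ a}ᶜ := by
    ext y; simp [not_le]
  rw [e, integral_add_compl hm (hwc.integrable_of_hasCompactSupport hws)]

end Summit.Ventures.Crystal3D.Theorems.PlateauHeight

end
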